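import Literature.AlgebraicGeometry.ShimuraVarieties.UnitaryShimuraCurveHeckeRealisation
import Literature.AlgebraicGeometry.ShimuraVarieties.UnitaryShimuraCurveConeReadSlices
import Literature.NumberTheory.Automorphic.UnitaryGroupAdelicLift
import Literature.NumberTheory.Automorphic.UnitaryCurveCohCotangentForms
import HarnessLib

/-!
# Crux `HLiu418`, line `F0_AlbCm`, sub-sub-line `F0_AlbCmS1Betti` — M5-glue part 1: the `(1,0)`-LIFT MAP of one level, and frame helpers

Floor-0 programme P5 (Alb-CM), seat F0P5-p01 (g0); crux item stmt-HodgeConjecture-24832 (`HCCMUnconditional.HLiu418`).  THEOREMS ONLY,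
letter-free and `sorry`-free.  HC_CM is proved only modulo the 7 printed citations until rung 0 closes.

For the record curve system `S : RecordSystemGS L J⋆ τ K₀`, one level `K` with pieces data `(gq, hgq, X, ι, B, hB)` of the shape of ★
`RecordSystemGS.pieces`, a `τ`-frame `(v₀, t₀)` and a class `z ∈ H¹((M_K ⊗_τ ℂ)(ℂ); ℂ)`:
* §1 `exists_oneZeroLift`: the cone-read family of the `(1,0)`-forms `ω_q(ι_q(ℂ)^* z)` (★ F1a `oneFormOfClass` ∘ `typeProj (1,0)`) is
  `Γ_q`-invariant (★ F2-H `family_rationalToArchLocal_mul`) over a section of the double cosets (★ M4-grp `cover_of_representatives` ∕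
  `disjoint_of_representatives`), hence LIFTS to `U(J⋆)(𝔸_{L⁺})` with M3's four properties (★ M3 `exists_lift_of_pieces`);
* §2 `exists_oneZeroLiftMap`: by uniqueness of lifts (★ `eq_of_forall_apply_adelicSingle_mul_eq`) the lift is `ℂ`-LINEAR in `z` (`Φ_K`);
* §3 helpers for part 2 (`Theorems/F0AlbCmS1LevelRealisation.lean`): `conj ∘ conj = id`, `cohForms₂` is `conj`-stable, disjoint summands, the
  cone frame in `τ`-coordinates (`embTwist`; base negative, direction not a multiple of the base), `σ(J⋆)` hermitian from one piece datum.
[cite: BorelJacquet1979, §4.3] [cite: BorelWallach2000, VII 2.10, 3.6 and XIII 1.2] [cite: Borel1997, §5.13–§5.14]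
[cite: BergeronMillsonMoeglin2016Balls, Part 2 §1.3]
-/

set_option autoImplicit false
set_option linter.dupNamespace false

noncomputable section

open Function MulAction Topology NumberField CategoryTheory Matrix AlgebraicGeometry
open scoped Matrix ComplexOrder Manifold
open Literature.AlgebraicGeometry.Motives
open Literature.NumberTheory.Automorphic Literature.NumberTheory.Automorphic.UnitaryGroup
open Literature.NumberTheory.Automorphic.UnitaryCurveForms
open Literature.NumberTheory.Automorphic.Liu2021.AppendixC (C5.OpenCompactSubgroup C5.SmallLevel)
open Literature.AlgebraicGeometry.HodgeTheory
open Literature.Geometry.Kaehler (MForm)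
open Literature.AlgebraicTopology.SingularHomology
open Literature.AlgebraicGeometry.ShimuraVarieties Literature.AlgebraicGeometry.ShimuraVarieties.UnitaryCanonicalModel

namespace Summit.HodgeConjecture.HodgeConjecture.Cruxes.HLiu418.S1OneZeroLift

variable {L : Type} [Field L] [NumberField L] [IsCMField L] {Jstar : Matrix (Fin 2) (Fin 2) L} {τ : L →+* ℂ}
  {K₀ : C5.OpenCompactSubgroup ↥(finAdelic (↥(maximalRealSubfield L)) L (IsCMField.complexConj L) 2 Jstar)}
  {S : RecordSystemGS L Jstar τ K₀} {K : C5.SmallLevel K₀}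
  {gq : orbitRel.Quotient ↥(rational (↥(maximalRealSubfield L)) L (IsCMField.complexConj L) 2 Jstar)
      (ShimuraDissection.CosetSpace (rationalToFinAdelic (↥(maximalRealSubfield L)) L (IsCMField.complexConj L) 2 Jstar) K.1.1) →
    ↥(finAdelic (↥(maximalRealSubfield L)) L (IsCMField.complexConj L) 2 Jstar)}
  {X : orbitRel.Quotient ↥(rational (↥(maximalRealSubfield L)) L (IsCMField.complexConj L) 2 Jstar)
      (ShimuraDissection.CosetSpace (rationalToFinAdelic (↥(maximalRealSubfield L)) L (IsCMField.complexConj L) 2 Jstar) K.1.1) →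
    SchemeOver ℂ}
  {ι : ∀ q, X q ⟶ (letI : Algebra L ℂ := τ.toAlgebra; (Literature.AlgebraicGeometry.Motives.baseChangeHom τ).obj (S.M.obj K))}
  {B : ∀ q, UnitaryBallUniformisationDatum 1 (X q)}

set_option maxHeartbeats 1600000 in
/-- **The `(1,0)`-LIFT of a class exists**: the cone-read family of the `(1,0)`-forms of `ι_q(ℂ)^* z` on the pieces lifts to a function on
`U(J⋆)(𝔸_{L⁺})` with M3's four properties. [cite: BorelJacquet1979, §4.3] [cite: BorelWallach2000, XIII 1.2] -/
theorem exists_oneZeroLift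
    (hgq : ∀ q, Quotient.mk'' (ShimuraDissection.CosetSpace.pt
      (rationalToFinAdelic (↥(maximalRealSubfield L)) L (IsCMField.complexConj L) 2 Jstar) K.1.1 (gq q)) = q)
    (hB : ∀ q, (B q).Hℂ = Jstar.map τ ∧
      (B q).Γ.map (Matrix.GeneralLinearGroup.map ((B q).τ₁ : ↥(B q).E →+* ℂ)) =
        (arithmeticLevel (↥(maximalRealSubfield L)) L (IsCMField.complexConj L) 2 Jstar
          (K.1.1.map (MulAut.conj (gq q)).toMonoidHom)).map (Matrix.GeneralLinearGroup.map τ))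
    {v₀ : Fin 2 → ℂ} (hv₀ : v₀ ∈ negCone (Jstar.map τ)) (t₀ : Fin 2 → ℂ)
    (z : letI : Algebra L ℂ := τ.toAlgebra; complexBetti ((Literature.AlgebraicGeometry.Motives.baseChangeHom τ).obj (S.M.obj K)) 1) :
    letI : Algebra L ℂ := τ.toAlgebra
    ∃ Φ : (adelicGroupData (↥(maximalRealSubfield L)) L (IsCMField.complexConj L) 2 Jstar).Adelic → ℂ,
      (∀ (δ : ↥(rational (↥(maximalRealSubfield L)) L (IsCMField.complexConj L) 2 Jstar))
          (x : (adelicGroupData (↥(maximalRealSubfield L)) L (IsCMField.complexConj L) 2 Jstar).Adelic),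
        Φ ((adelicGroupData (↥(maximalRealSubfield L)) L (IsCMField.complexConj L) 2 Jstar).toAdelic δ * x) = Φ x) ∧
      (∀ k ∈ ((archAt (↥(maximalRealSubfield L)) L (IsCMField.complexConj L) 2 Jstar (cmPlace L τ)
            (UnitaryGroup.complexConj_smul_infinitePlace L _) (IsCMField.complexConj_ne_one L)).ker).map
          (archToAdelic (↥(maximalRealSubfield L)) L (IsCMField.complexConj L) 2 Jstar),
        ∀ x : (adelicGroupData (↥(maximalRealSubfield L)) L (IsCMField.complexConj L) 2 Jstar).Adelic, Φ (x * k) = Φ x) ∧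
      (∀ k ∈ K.1.1, ∀ x : (adelicGroupData (↥(maximalRealSubfield L)) L (IsCMField.complexConj L) 2 Jstar).Adelic,
        Φ (x * finAdelicToAdelic (↥(maximalRealSubfield L)) L (IsCMField.complexConj L) 2 Jstar k) = Φ x) ∧
      ∀ (q : orbitRel.Quotient ↥(rational (↥(maximalRealSubfield L)) L (IsCMField.complexConj L) 2 Jstar)
          (ShimuraDissection.CosetSpace (rationalToFinAdelic (↥(maximalRealSubfield L)) L (IsCMField.complexConj L) 2 Jstar) K.1.1))
        (u : archLocal L 2 Jstar (cmPlace L τ)),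
        Φ (adelicSingle (↥(maximalRealSubfield L)) L (IsCMField.complexConj L) 2 Jstar (IsCMField.complexConj_ne_one L)
            (UnitaryGroup.complexConj_smul_infinitePlace L) (cmPlace L τ) u *
          finAdelicToAdelic (↥(maximalRealSubfield L)) L (IsCMField.complexConj L) 2 Jstar (gq q)) =
        ((algebraicModel (B q).isSmoothProjective).oneFormOfClass (B q).isSmoothProjective
            (algebraicModel (B q).isSmoothProjective).holFormsClosed_top
          (((algebraicModel (B q).isSmoothProjective).complexification (B q).isSmoothProjective 1).symm
            ((algebraicModel (B q).isSmoothProjective).pullbackEquiv 1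
              ((algebraicModel (B q).isSmoothProjective).typeProj 1 ⟨(1, 0), Finset.HasAntidiagonal.mem_antidiagonal.2 rfl⟩
                (complexBetti.map (ι q) 1 z)))) :
            MForm 𝓘(ℝ, (algebraicModel (B q).isSmoothProjective).model) (algebraicModel (B q).isSmoothProjective).carrier ℂ 1)
          ((⇑(algebraicModel (B q).isSmoothProjective).isAnalytification.homeomorph.symm ∘ (B q).unif)
            ((((u : GL (Fin 2) ℂ) : Matrix (Fin 2) (Fin 2) ℂ).map (embTwist L τ)) *ᵥ v₀))
          (fun _ ↦ mfderiv 𝓘(ℝ, Fin 2 → ℂ) 𝓘(ℝ, (algebraicModel (B q).isSmoothProjective).model)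
            (⇑(algebraicModel (B q).isSmoothProjective).isAnalytification.homeomorph.symm ∘ (B q).unif)
            ((((u : GL (Fin 2) ℂ) : Matrix (Fin 2) (Fin 2) ℂ).map (embTwist L τ)) *ᵥ v₀)
            ((((u : GL (Fin 2) ℂ) : Matrix (Fin 2) (Fin 2) ℂ).map (embTwist L τ)) *ᵥ t₀)) := by
  letI : Algebra L ℂ := τ.toAlgebra
  refine exists_lift_of_pieces (cover_of_representatives (hgq := hgq)) (disjoint_of_representatives (hgq := hgq)) _ ?_
  intro q δ hδ u
  exact family_rationalToArchLocal_mul hB (fun q => algebraicModel (B q).isSmoothProjective)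
    (fun q => ((algebraicModel (B q).isSmoothProjective).oneFormOfClass (B q).isSmoothProjective (algebraicModel (B q).isSmoothProjective).holFormsClosed_top (((algebraicModel (B q).isSmoothProjective).complexification (B q).isSmoothProjective 1).symm ((algebraicModel (B q).isSmoothProjective).pullbackEquiv 1 ((algebraicModel (B q).isSmoothProjective).typeProj 1 ⟨(1, 0), Finset.HasAntidiagonal.mem_antidiagonal.2 rfl⟩ (complexBetti.map (ι q) 1 z)))) : MForm 𝓘(ℝ, (algebraicModel (B q).isSmoothProjective).model) (algebraicModel (B q).isSmoothProjective).carrier ℂ 1))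
    hv₀ t₀ q δ hδ u

set_option maxHeartbeats 1600000 in
/-- **The `(1,0)`-lift as a `ℂ`-LINEAR map** `z ↦ Φ_K[z]`: the lifts are unique (★ `eq_of_forall_apply_adelicSingle_mul_eq`) and the family is
`ℂ`-linear in the class (every arrow `ι_q^*`, `π^{1,0}`, `Θ⁻¹`, `oneFormOfClass` is linear; evaluation of forms is linear). [cite: BorelJacquet1979, §4.3]
[cite: BorelWallach2000, XIII 1.2] -/
theorem exists_oneZeroLiftMap
    (hgq : ∀ q, Quotient.mk'' (ShimuraDissection.CosetSpace.pt
      (rationalToFinAdelic (↥(maximalRealSubfield L)) L (IsCMField.complexConj L) 2 Jstar) K.1.1 (gq q)) = q)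
    (hB : ∀ q, (B q).Hℂ = Jstar.map τ ∧
      (B q).Γ.map (Matrix.GeneralLinearGroup.map ((B q).τ₁ : ↥(B q).E →+* ℂ)) =
        (arithmeticLevel (↥(maximalRealSubfield L)) L (IsCMField.complexConj L) 2 Jstar
          (K.1.1.map (MulAut.conj (gq q)).toMonoidHom)).map (Matrix.GeneralLinearGroup.map τ))
    {v₀ : Fin 2 → ℂ} (hv₀ : v₀ ∈ negCone (Jstar.map τ)) (t₀ : Fin 2 → ℂ) :
    letI : Algebra L ℂ := τ.toAlgebra
    ∃ Φ : complexBetti ((Literature.AlgebraicGeometry.Motives.baseChangeHom τ).obj (S.M.obj K)) 1 →ₗ[ℂ]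
        ((adelicGroupData (↥(maximalRealSubfield L)) L (IsCMField.complexConj L) 2 Jstar).Adelic → ℂ),
      ∀ z : complexBetti ((Literature.AlgebraicGeometry.Motives.baseChangeHom τ).obj (S.M.obj K)) 1,
      (∀ (δ : ↥(rational (↥(maximalRealSubfield L)) L (IsCMField.complexConj L) 2 Jstar)) (x : (adelicGroupData (↥(maximalRealSubfield L)) L (IsCMField.complexConj L) 2 Jstar).Adelic),
        Φ z ((adelicGroupData (↥(maximalRealSubfield L)) L (IsCMField.complexConj L) 2 Jstar).toAdelic δ * x) = Φ z x) ∧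
      (∀ k ∈ ((archAt (↥(maximalRealSubfield L)) L (IsCMField.complexConj L) 2 Jstar (cmPlace L τ)
            (UnitaryGroup.complexConj_smul_infinitePlace L _) (IsCMField.complexConj_ne_one L)).ker).map
          (archToAdelic (↥(maximalRealSubfield L)) L (IsCMField.complexConj L) 2 Jstar),
        ∀ x : (adelicGroupData (↥(maximalRealSubfield L)) L (IsCMField.complexConj L) 2 Jstar).Adelic, Φ z (x * k) = Φ z x) ∧
      (∀ k ∈ K.1.1, ∀ x : (adelicGroupData (↥(maximalRealSubfield L)) L (IsCMField.complexConj L) 2 Jstar).Adelic,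
        Φ z (x * finAdelicToAdelic (↥(maximalRealSubfield L)) L (IsCMField.complexConj L) 2 Jstar k) = Φ z x) ∧
      ∀ (q : orbitRel.Quotient ↥(rational (↥(maximalRealSubfield L)) L (IsCMField.complexConj L) 2 Jstar)
          (ShimuraDissection.CosetSpace (rationalToFinAdelic (↥(maximalRealSubfield L)) L (IsCMField.complexConj L) 2 Jstar) K.1.1))
        (u : archLocal L 2 Jstar (cmPlace L τ)),
        Φ z (adelicSingle (↥(maximalRealSubfield L)) L (IsCMField.complexConj L) 2 Jstar (IsCMField.complexConj_ne_one L)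
            (UnitaryGroup.complexConj_smul_infinitePlace L) (cmPlace L τ) u *
          finAdelicToAdelic (↥(maximalRealSubfield L)) L (IsCMField.complexConj L) 2 Jstar (gq q)) =
        (((algebraicModel (B q).isSmoothProjective).oneFormOfClass (B q).isSmoothProjective (algebraicModel (B q).isSmoothProjective).holFormsClosed_top (((algebraicModel (B q).isSmoothProjective).complexification (B q).isSmoothProjective 1).symm ((algebraicModel (B q).isSmoothProjective).pullbackEquiv 1 ((algebraicModel (B q).isSmoothProjective).typeProj 1 ⟨(1, 0), Finset.HasAntidiagonal.mem_antidiagonal.2 rfl⟩ (complexBetti.map (ι q) 1 z)))) : MForm 𝓘(ℝ, (algebraicModel (B q).isSmoothProjective).model) (algebraicModel (B q).isSmoothProjective).carrier ℂ 1)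
          ((⇑(algebraicModel (B q).isSmoothProjective).isAnalytification.homeomorph.symm ∘ (B q).unif)
            ((((u : GL (Fin 2) ℂ) : Matrix (Fin 2) (Fin 2) ℂ).map (embTwist L τ)) *ᵥ v₀))
          (fun _ ↦ mfderiv 𝓘(ℝ, Fin 2 → ℂ) 𝓘(ℝ, (algebraicModel (B q).isSmoothProjective).model)
            (⇑(algebraicModel (B q).isSmoothProjective).isAnalytification.homeomorph.symm ∘ (B q).unif)
            ((((u : GL (Fin 2) ℂ) : Matrix (Fin 2) (Fin 2) ℂ).map (embTwist L τ)) *ᵥ v₀)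
            ((((u : GL (Fin 2) ℂ) : Matrix (Fin 2) (Fin 2) ℂ).map (embTwist L τ)) *ᵥ t₀))) := by
  letI : Algebra L ℂ := τ.toAlgebra
  classical
  -- pointwise lifts
  have hex := fun z => exists_oneZeroLift (S := S) (ι := ι) (B := B) hgq hB hv₀ t₀ z
  choose Φ₀ hL hKc hK hΦ using hex
  -- the family is additive and homogeneous in the class
  have hcov := cover_of_representatives (K := K.1.1) (hgq := hgq)
  have hadd : ∀ z z', Φ₀ (z + z') = Φ₀ z + Φ₀ z' := by
    intro z z'
    refine eq_of_forall_apply_adelicSingle_mul_eq hcov (hL _) (hKc _) (hK _)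
      (fun δ x => by simp only [Pi.add_apply, hL]) (fun k hk x => by simp only [Pi.add_apply, hKc _ k hk])
      (fun k hk x => by simp only [Pi.add_apply, hK _ k hk]) (fun q u => ?_)
    rw [Pi.add_apply, hΦ, hΦ, hΦ]
    simp only [map_add, Submodule.coe_add, Pi.add_apply, ContinuousAlternatingMap.add_apply]
  have hsmul : ∀ (a : ℂ) z, Φ₀ (a • z) = a • Φ₀ z := by
    intro a z
    refine eq_of_forall_apply_adelicSingle_mul_eq hcov (hL _) (hKc _) (hK _)
      (fun δ x => by simp only [Pi.smul_apply, hL]) (fun k hk x => by simp only [Pi.smul_apply, hKc _ k hk])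
      (fun k hk x => by simp only [Pi.smul_apply, hK _ k hk]) (fun q u => ?_)
    rw [Pi.smul_apply, hΦ, hΦ]
    simp only [map_smul, Submodule.coe_smul, Pi.smul_apply, ContinuousAlternatingMap.smul_apply, smul_eq_mul]
  exact ⟨{ toFun := Φ₀, map_add' := hadd, map_smul' := hsmul }, fun z => ⟨hL z, hKc z, hK z, hΦ z⟩⟩

/-! ## §3 Small helpers: `conj ∘ conj`, `cohForms₂` is `conj`-stable, disjoint summands, the τ-coordinates of a cone frame -/

section Generic

variable (F E : Type) [Field F] [NumberField F] [Field E] [NumberField E] [Algebra F E]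
  (c : E ≃ₐ[F] E) (J : Matrix (Fin 2) (Fin 2) E) (hc : c ≠ 1) (hfix : ∀ w : InfinitePlace E, c • w = w)
  (w₁ : {w : InfinitePlace E // InfinitePlace.IsComplex w})

/-- `conj (conj f) = f` for functions on `U(J)(𝔸)`. [cite: BorelWallach2000, VII 2.10] -/
theorem conjFun₂_conjFun₂ (f : (adelicGroupData F E c 2 J).Adelic → ℂ) :
    conjFun₂ F E c J (conjFun₂ F E c J f) = f := by
  funext x
  rw [conjFun₂_apply, conjFun₂_apply, star_star]

/-- `cohForms₂ 𝔣 = holCotForms₂ 𝔣 ⊔ conj (holCotForms₂ 𝔣)` is stable under `conj`. [cite: BorelWallach2000, VII 3.6] -/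
theorem conjFun₂_mem_cohForms₂_of_mem (𝔣 : ConeFrame E J w₁) {f : (adelicGroupData F E c 2 J).Adelic → ℂ}
    (hf : f ∈ cohForms₂ F E c J hc hfix w₁ 𝔣) : conjFun₂ F E c J f ∈ cohForms₂ F E c J hc hfix w₁ 𝔣 := by
  obtain ⟨f₁, hf₁, f₂, hf₂, rfl⟩ := Submodule.mem_sup.1 hf
  obtain ⟨f₀, hf₀, rfl⟩ := Submodule.mem_map.1 hf₂
  rw [map_add, conjFun₂_conjFun₂]
  exact add_mem (conjFun₂_mem_cohForms₂ F E c J hc hfix w₁ 𝔣 hf₁) (holCotForms₂_le_cohForms₂ F E c J hc hfix w₁ 𝔣 hf₀)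

end Generic

/-- In a module, if `a ∈ P`, `b ∈ Q`, `P ⊓ Q = ⊥` and `a + b = 0` then `a = 0` and `b = 0`. [folklore] [cite: BorelWallach2000, VII 3.6] -/
theorem eq_zero_of_disjoint_of_add_eq_zero {V : Type*} [AddCommGroup V] [Module ℂ V] {P Q : Submodule ℂ V} (h : Disjoint P Q)
    {a b : V} (ha : a ∈ P) (hb : b ∈ Q) (hab : a + b = 0) : a = 0 ∧ b = 0 := by
  have ha' : a ∈ Q := by
    rw [eq_neg_of_add_eq_zero_left hab]
    exact Q.neg_mem hb
  have h0 : a = 0 := (Submodule.disjoint_def.1 h) a ha ha'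
  refine ⟨h0, ?_⟩
  rwa [h0, zero_add] at hab

section Frame

variable (L : Type) [Field L] [NumberField L] [IsCMField L] (Jstar : Matrix (Fin 2) (Fin 2) L) (τ : L →+* ℂ)

/-- The base vector of a cone frame at the place of `τ`, untwisted to `τ`-coordinates, twists back to itself. [folklore] [cite: BergeronMillsonMoeglin2016Balls, Part 2 §1.3] -/
theorem coneFrame_v₀_eq (𝔣 : ConeFrame L Jstar (cmPlace L τ)) : 𝔣.v₀ = fun i => embTwist L τ (embTwist L τ (𝔣.v₀ i)) :=
  funext fun _ => (embTwist_embTwist L τ _).symm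

/-- Same for the direction vector. [folklore] [cite: BergeronMillsonMoeglin2016Balls, Part 2 §1.3] -/
theorem coneFrame_t₀_eq (𝔣 : ConeFrame L Jstar (cmPlace L τ)) : 𝔣.t₀ = fun i => embTwist L τ (embTwist L τ (𝔣.t₀ i)) :=
  funext fun _ => (embTwist_embTwist L τ _).symm

/-- The untwisted base vector is negative for `J⋆^τ` (★ `mem_negCone_of_embTwist_eq`). [cite: BergeronMillsonMoeglin2016Balls, Part 2 §1.3] -/
theorem embTwist_v₀_mem_negCone (𝔣 : ConeFrame L Jstar (cmPlace L τ)) :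
    (fun i => embTwist L τ (𝔣.v₀ i)) ∈ negCone (Jstar.map τ) :=
  mem_negCone_of_embTwist_eq τ (isComplex_mk_of_isCMField L τ) Jstar (coneFrame_v₀_eq L Jstar τ 𝔣) 𝔣.v₀_mem

/-- **The direction of a cone frame is not a multiple of its base vector** (in `τ`-coordinates): were `t₀ = a v₀`, orthogonality
`⟨t₀, J v₀⟩ = 0` and negativity `⟨v₀, J v₀⟩ < 0` force `a = 0`, `t₀ = 0`, contradicting positivity `⟨t₀, J t₀⟩ > 0`. [folklore] [cite: Borel1997, §5.13] -/
theorem embTwist_t₀_ne_smul (𝔣 : ConeFrame L Jstar (cmPlace L τ)) (a : ℂ) :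
    (fun i => embTwist L τ (𝔣.t₀ i)) ≠ a • fun i => embTwist L τ (𝔣.v₀ i) := by
  intro h
  have h' : 𝔣.t₀ = embTwist L τ a • 𝔣.v₀ := by
    funext i
    have hi := congrFun h i
    simp only [Pi.smul_apply, smul_eq_mul] at hi
    have hi' := congrArg (embTwist L τ) hi
    rw [embTwist_embTwist, map_mul, embTwist_embTwist] at hi'
    rw [Pi.smul_apply, smul_eq_mul]
    exact hi'
  have hneg : (star 𝔣.v₀ ⬝ᵥ (Jstar.map (cmPlace L τ).1.embedding *ᵥ 𝔣.v₀)).re < 0 := mem_negCone_iff.1 𝔣.v₀_mem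
  have horth := 𝔣.orth
  rw [h', star_smul, smul_dotProduct, smul_eq_mul, mul_eq_zero] at horth
  have ha0 : embTwist L τ a = 0 := by
    rcases horth with h0 | h0
    · exact star_eq_zero.1 h0
    · exact absurd (by rw [h0, Complex.zero_re]) (ne_of_lt hneg)
  have hpos := 𝔣.t₀_pos
  rw [h', ha0, zero_smul, star_zero, zero_dotProduct, Complex.zero_re] at hpos
  exact lt_irrefl _ hpos

/-- `σ(J⋆)` is hermitian at the place of `τ` as soon as ONE piece datum reads `H_ℂ = J⋆^τ` (the datum's `H` is hermitian, ★ `isHermitian_Hℂ`;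
`σ(J⋆) = embTwist (J⋆^τ)` entrywise, ★ `map_map_embTwist`). [cite: BergeronMillsonMoeglin2016Balls, Part 2 §1.3] -/
theorem isHermitian_map_embedding_of_Hℂ_eq {Xq : SchemeOver ℂ} (D : UnitaryBallUniformisationDatum 1 Xq) (hH : D.Hℂ = Jstar.map τ) :
    (Jstar.map (cmPlace L τ).1.embedding).IsHermitian := by
  have h1 : (Jstar.map τ).IsHermitian := hH ▸ D.isHermitian_Hℂ
  have h2 := h1.map (embTwist L τ) (embTwist_conj L τ)
  rw [map_map_embTwist L 2 Jstar τ (isComplex_mk_of_isCMField L τ)] at h2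
  exact h2

end Frame

end Summit.HodgeConjecture.HodgeConjecture.Cruxes.HLiu418.S1OneZeroLift
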